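import Summits.QuantumFields.BalabanUV.T4Continuum.Support.NE7LatticeUhlenbeckInvariant
import HarnessLib

/-!
# NE7 — THE INCREMENTAL CONSTRUCTION RUN TO THE END: from the trivial gauge at `s = 0` through `N` steps of size `1∕N` to a small exact free-boundary
# Landau gauge of `e^{B}` on the box, `‖log(g e^{B} gᴴ)‖ ≤ ρ⋆∕2`, under the step conditions (C1)–(C4) of F313a held uniformly along the path (F313b)

Cell `pub-balaban`, rung (B)+1 sub-cell t4, lineage `b2b-balaban-t4-ne7-p1` (CRUX PROVER NE7 #1 = OWNER of row NE7), generation 93; memo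
`t4/b2b-balaban-t4-ne7-p1-g93/UHLENBECK-ROAD.md` §5.  Over F313a `NE7LatticeUhlenbeckInvariant.invariant_step`.

THE STATEMENT.  `B` skew with `‖B‖ ≤ b₀`; the plaquettes of `e^{sB}` on the box `periodBox (m+1)` within `ε′` of `1` for every `s ∈ [0,1]`; a radius
`ρ⋆ ≤ ¼`, a ball radius `θ > 0` and a step number `N ≥ 1` such that (C1)–(C4) hold with `δ = 1∕N`.  THEN there are a unitary site gauge `g` (`= 1` off
the box, `g 0 = 1`) and a skew `A` with `e^{A(x,κ)} = g_x e^{B(x,κ)} g_{x+e_κ}ᴴ` on the box bonds, `‖A‖ ≤ ρ⋆∕2`, and the free-boundary lattice Landau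
condition at every site of the box — the invariant `I(j∕N)` by induction on `j`, from `I(0)` (`g = 1`, `A = 0`).
What remains for the lattice Uhlenbeck lemma (F313c∕F314): choose `ρ⋆ = 4·64d³M·ε′`, then `θ` and `N` (depending on `M`, `n`, `d`, `b₀`) so that
(C1)–(C4) hold in the regime `M²ε′ ≪ 1`, and feed the comb gauge of a small-field configuration (`B = log U^{comb}`).

WHAT ([folklore]; 0 def, 0 sorry): **`uhlenbeck_box_of_steps`**.
HONEST FRAMING (page 1): a lattice-gauge lemma for ARBITRARY skew `B` on a box; nothing of Bałaban's asserted; NE7 NOT PROVED here; spine 0∕9; finite T⁴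
rung (B)+1 — NOT infinite volume, NOT mass gap, NOT `BetaPertH`, NOT Clay.  No `sorry`; axioms ⊆ {propext, Classical.choice, Quot.sound}.
-/

set_option autoImplicit false

open scoped BigOperators Matrix Matrix.Norms.L2Operator
open Finset NormedSpace Set

namespace Summit.QuantumFields.BalabanUV.T4Continuum.NE7LatticeUhlenbeckSteps

open Literature.MathematicalPhysics.QuantumFieldTheory.Balaban1983to89
open B7Prop1Explicit UnitaryModel MatrixNorms
open T4AveragingDeficitWallBoundary (periodBox mem_periodBox)
open NE7LatticeUhlenbeckInvariant (invariant_step)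

noncomputable section

variable {d : ℕ} {n : Type*} [Fintype n] [DecidableEq n] [Nonempty n]

set_option maxHeartbeats 1600000 in
/-- **THE INCREMENTAL CONSTRUCTION RUN TO THE END** (`d ≥ 1`, `m ≥ 1`): under the step conditions (C1)–(C4) of F313a with `δ = 1∕N` and the plaquette
bound `ε′` along the whole path `s ∈ [0,1]`, the links `e^{B}` on the box admit a unitary, pinned site gauge in which they are `e^{A}` with `A` skew,
`‖A‖ ≤ ρ⋆∕2`, satisfying the free-boundary lattice Landau condition at every box site. [folklore] -/
theorem uhlenbeck_box_of_steps (hd : 1 ≤ d) {m : ℕ} (hm : 1 ≤ m) (B : Site d → Fin d → Matrix n n ℂ)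
    (hBskew : ∀ x κ, B x κ ∈ skewAdjoint (Matrix n n ℂ)) {b₀ : ℝ} (hB : ∀ x κ, ‖B x κ‖ ≤ b₀) {ε' ρs θ : ℝ} {N : ℕ} (hN : 1 ≤ N)
    (hε' : 0 ≤ ε') (hρs0 : 0 ≤ ρs) (hρs4 : ρs ≤ 1 / 4) (hθ : 0 < θ)
    (hplaq : ∀ s ∈ Icc (0 : ℝ) 1, ∀ (q : Site d) (μ ν : Fin d), μ ≠ ν → q ∈ periodBox (d := d) (m + 1) → q + e μ ∈ periodBox (d := d) (m + 1) →
      q + e ν ∈ periodBox (d := d) (m + 1) → q + e μ + e ν ∈ periodBox (d := d) (m + 1) →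
      ‖exp ((s : ℂ) • B q μ) * exp ((s : ℂ) • B (q + e μ) ν) * (exp ((s : ℂ) • B (q + e ν) μ))ᴴ * (exp ((s : ℂ) • B q ν))ᴴ - 1‖ ≤ ε')
    (hC1 : Real.pi / 2 * ((1 + θ) * (Real.exp (ρs / 2) * Real.exp (1 / N * b₀)) * (1 + θ) - 1) ≤ ρs)
    (hC2 : 64 * (d : ℝ) ^ 3 * ((m + 1 : ℕ) : ℝ) * (ε' + 36 * ρs ^ 2) ≤ ρs / 2)
    (hC3 : (Fintype.card n : ℝ) * (Real.exp (2 * (Real.pi / 2 * θ)) * (1 + (Real.exp (ρs / 2) * Real.exp (1 / N * b₀) - 1)) - 1)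
      + 2 * (Fintype.card n : ℝ) * d * (m + 1) * (Real.exp (2 * (Real.pi / 2 * θ)) * (1 + (Real.exp (ρs / 2) * Real.exp (1 / N * b₀) - 1)) - 1)
        ≤ 1 / 2)
    (hC4 : (1 / 2) * (((m + 1 : ℕ) : ℝ) ^ d * ((Real.pi / 2 * θ) * (4 * d * (Real.exp (1 / N * b₀) - 1))))
      + (1 / 2) * ((Real.pi / 2 * θ) ^ 2 * ((m + 1 : ℕ) : ℝ) ^ d * ((4 * d * (Real.exp (1 / N * b₀) - 1))
        + 4 * d * ((1 + (Real.exp (ρs / 2) * Real.exp (1 / N * b₀) - 1)) * (Real.exp (2 * (Real.pi / 2 * θ)) - 1))))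
      < θ ^ 2 / (4 * (Fintype.card n : ℝ) * d ^ 2 * m ^ 2)) :
    ∃ (g : Site d → Matrix n n ℂ) (A : Site d → Fin d → Matrix n n ℂ), (∀ x, g x ∈ Matrix.unitaryGroup n ℂ) ∧
      (∀ x, x ∉ periodBox (d := d) (m + 1) → g x = 1) ∧ g 0 = 1 ∧
      (∀ (x : Site d) (κ : Fin d), x ∈ periodBox (d := d) (m + 1) → x + e κ ∈ periodBox (d := d) (m + 1) → A x κ ∈ skewAdjoint (Matrix n n ℂ)) ∧
      (∀ (x : Site d) (κ : Fin d), x ∈ periodBox (d := d) (m + 1) → x + e κ ∈ periodBox (d := d) (m + 1) →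
        exp (A x κ) = g x * exp (B x κ) * (g (x + e κ))ᴴ) ∧
      (∀ (x : Site d) (κ : Fin d), x ∈ periodBox (d := d) (m + 1) → x + e κ ∈ periodBox (d := d) (m + 1) → ‖A x κ‖ ≤ ρs / 2) ∧
      (∀ y ∈ periodBox (d := d) (m + 1), ∑ κ : Fin d,
        ((if y + e κ ∈ periodBox (d := d) (m + 1) then (exp (A y κ) - exp (-A y κ)) else 0)
          - (if y - e κ ∈ periodBox (d := d) (m + 1) then (exp (A (y - e κ) κ) - exp (-A (y - e κ) κ)) else 0)) = 0) := by
  have hN0 : (0 : ℝ) < N := by exact_mod_cast hN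
  -- the invariant at parameter `j / N`, by induction on `j ≤ N`
  have hind : ∀ j : ℕ, j ≤ N → ∃ (g : Site d → Matrix n n ℂ) (A : Site d → Fin d → Matrix n n ℂ), (∀ x, g x ∈ Matrix.unitaryGroup n ℂ) ∧
      (∀ x, x ∉ periodBox (d := d) (m + 1) → g x = 1) ∧ g 0 = 1 ∧
      (∀ (x : Site d) (κ : Fin d), x ∈ periodBox (d := d) (m + 1) → x + e κ ∈ periodBox (d := d) (m + 1) → A x κ ∈ skewAdjoint (Matrix n n ℂ)) ∧
      (∀ (x : Site d) (κ : Fin d), x ∈ periodBox (d := d) (m + 1) → x + e κ ∈ periodBox (d := d) (m + 1) →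
        exp (A x κ) = g x * exp ((((j : ℝ) / N : ℝ) : ℂ) • B x κ) * (g (x + e κ))ᴴ) ∧
      (∀ (x : Site d) (κ : Fin d), x ∈ periodBox (d := d) (m + 1) → x + e κ ∈ periodBox (d := d) (m + 1) → ‖A x κ‖ ≤ ρs / 2) ∧
      (∀ y ∈ periodBox (d := d) (m + 1), ∑ κ : Fin d,
        ((if y + e κ ∈ periodBox (d := d) (m + 1) then (exp (A y κ) - exp (-A y κ)) else 0)
          - (if y - e κ ∈ periodBox (d := d) (m + 1) then (exp (A (y - e κ) κ) - exp (-A (y - e κ) κ)) else 0)) = 0) := by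
    intro j
    induction j with
    | zero =>
      intro _
      refine ⟨fun _ => 1, fun _ _ => 0, fun _ => (unitary _).one_mem, fun _ _ => rfl, rfl, fun _ _ _ _ => (skewAdjoint _).zero_mem, ?_, ?_, ?_⟩
      · intro x κ _ _
        simp only [Nat.cast_zero, zero_div, Complex.ofReal_zero, zero_smul, exp_zero, Matrix.conjTranspose_one, mul_one]
      · intro x κ _ _; rw [norm_zero]; linarith
      · intro y _
        refine Finset.sum_eq_zero fun κ _ => ?_
        simp only [neg_zero, exp_zero, sub_self, ite_self]
    | succ j ih =>
      intro hj
      obtain ⟨g, A, hgu, hg1, hg0, hAskew, hAexp, hAρ, hEL⟩ := ih (by omega)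
      have hs1 : ((j : ℝ) / N) + 1 / N = ((j + 1 : ℕ) : ℝ) / N := by push_cast; ring
      have hsmem : ((j + 1 : ℕ) : ℝ) / N ∈ Icc (0 : ℝ) 1 := by
        refine ⟨by positivity, ?_⟩
        rw [div_le_one hN0]; exact_mod_cast hj
      have hstep := invariant_step (n := n) hd hm B hBskew hB (s := (j : ℝ) / N) (δ := 1 / N) (ε' := ε') (ρs := ρs) (θ := θ)
        (by positivity) hε' hρs4 hθ (by rw [hs1]; exact hplaq _ hsmem) hC1 hC2 hC3 hC4 g hgu hg1 hg0 A hAskew hAexp hAρ hEL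
      obtain ⟨g', A', hg'u, hg'1, hg'0, hA'skew, hA'exp, hA'ρ, hEL'⟩ := hstep
      refine ⟨g', A', hg'u, hg'1, hg'0, hA'skew, fun x κ hx hxκ => ?_, hA'ρ, hEL'⟩
      rw [hA'exp x κ hx hxκ, hs1]
  obtain ⟨g, A, hgu, hg1, hg0, hAskew, hAexp, hAρ, hEL⟩ := hind N le_rfl
  refine ⟨g, A, hgu, hg1, hg0, hAskew, fun x κ hx hxκ => ?_, hAρ, hEL⟩
  rw [hAexp x κ hx hxκ, div_self hN0.ne', Complex.ofReal_one, one_smul]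

end

end Summit.QuantumFields.BalabanUV.T4Continuum.NE7LatticeUhlenbeckSteps
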